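import Summits.AtomisticToContinuum.Crystallization.Theorems.ReggeStarCoercivityDefectFreeCrystallizesLayeredGluing04

/-!
# Part 5 of the proof of `stub_layeredGluing : LayeredGluing` (S5a, line `prestress-split-korn`, crux stmt-AtomisticToContinuum-13603); see the module docstring of the final part `ReggeStarCoercivityDefectFreeCrystallizesLayeredGluing.lean` for the overview
-/

noncomputable section

open scoped BigOperators Classical InnerProductSpace
open Filter Topology

namespace Summit.AtomisticToContinuum.Crystallization.Theorems.PrestressSplitKorn

open Summit.AtomisticToContinuum.Crystallization.Theses
open Summit.AtomisticToContinuum.Crystallization.Theses.ReggeStarCoercivity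
open Summit.AtomisticToContinuum.Crystallization.Theorems.DefectFreeCrystallizes.Negative.PredicateAPI
open Literature.MathematicalPhysics.StatisticalMechanics Literature.Geometry.DiscreteGeometry


section Framed

variable {a : ℝ} {s : ℤ → ℤ} {z : ℤ → ℝ}
variable {Y : Set (EuclideanSpace ℝ (Fin 3))}

/-- **Part II.** If every point of `Y` carries an identity-framed exact template of spacing `a`,
then `Y` is ONE identity-framed box template based at any of its points. -/
theorem global_of_framed {a : ℝ} {Y : Set (EuclideanSpace ℝ (Fin 3))} (hY : AllFramed a Y) {p₀ : EuclideanSpace ℝ (Fin 3)} (hp₀ : p₀ ∈ Y) :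
    ∃ (S : ℤ → ℤ) (Z : ℤ → ℝ), InBox a Z ∧ IsHaggSeq S ∧ Z 0 = 0 ∧
      Y = {y | ∃ l, y = p₀ + layeredPos a S Z l} := by
  classical
  -- choice of framed data at every point
  have hdat : ∀ p : EuclideanSpace ℝ (Fin 3), ∃ (s : ℤ → ℤ) (z : ℤ → ℝ), p ∈ Y → FramedAt a Y p s z := by
    intro p
    by_cases hp : p ∈ Y
    · obtain ⟨s, z, h⟩ := hY p hp; exact ⟨s, z, fun _ => h⟩
    · exact ⟨fun _ => 1, fun m => m, fun h => absurd h hp⟩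
  choose sd zd hsd using hdat
  obtain ⟨hbox0, -, -, -, -⟩ := hsd p₀ hp₀
  -- base points of the layers, upwards and downwards
  let bU : ℕ → EuclideanSpace ℝ (Fin 3) := fun n => Nat.rec (motive := fun _ => EuclideanSpace ℝ (Fin 3)) p₀
    (fun _ b => b + ((sd b 0 : ℝ) • barlowOffset a + zd b 1 • layerNormal 1)) n
  let bD : ℕ → EuclideanSpace ℝ (Fin 3) := fun n => Nat.rec (motive := fun _ => EuclideanSpace ℝ (Fin 3)) p₀
    (fun _ b => b + ((-(sd b (-1)) : ℝ) • barlowOffset a + zd b (-1) • layerNormal 1)) n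
  have bU_zero : bU 0 = p₀ := rfl
  have bD_zero : bD 0 = p₀ := rfl
  have bU_succ : ∀ n, bU (n + 1) = bU n + ((sd (bU n) 0 : ℝ) • barlowOffset a + zd (bU n) 1 • layerNormal 1) :=
    fun n => rfl
  have bD_succ : ∀ n, bD (n + 1) =
      bD n + ((-(sd (bD n) (-1)) : ℝ) • barlowOffset a + zd (bD n) (-1) • layerNormal 1) := fun n => rfl
  have hbU : ∀ n, bU n ∈ Y := by
    intro n
    induction n with
    | zero => exact hp₀
    | succ n ih => rw [bU_succ]; exact (hsd _ ih).up_mem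
  have hbD : ∀ n, bD n ∈ Y := by
    intro n
    induction n with
    | zero => exact hp₀
    | succ n ih => rw [bD_succ]; exact (hsd _ ih).down_mem
  -- the global word and heights
  let ZU : ℕ → ℝ := fun n => Nat.rec (motive := fun _ => ℝ) 0 (fun n h => h + zd (bU n) 1) n
  let ZD : ℕ → ℝ := fun n => Nat.rec (motive := fun _ => ℝ) 0 (fun n h => h + zd (bD n) (-1)) n
  have ZU_succ : ∀ n, ZU (n + 1) = ZU n + zd (bU n) 1 := fun n => rfl
  have ZD_succ : ∀ n, ZD (n + 1) = ZD n + zd (bD n) (-1) := fun n => rfl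
  let S : ℤ → ℤ := fun k => if 0 ≤ k then sd (bU k.toNat) 0 else sd (bD (-k - 1).toNat) (-1)
  let Z : ℤ → ℝ := fun k => if 0 ≤ k then ZU k.toNat else ZD (-k).toNat
  have S_nat : ∀ n : ℕ, S n = sd (bU n) 0 := fun n => by
    simp only [S, if_pos (Int.natCast_nonneg n), Int.toNat_natCast]
  have S_neg : ∀ n : ℕ, S (-((n : ℤ) + 1)) = sd (bD n) (-1) := fun n => by
    have h1 : ¬ (0 : ℤ) ≤ -((n : ℤ) + 1) := by omega
    have h2 : (-(-((n : ℤ) + 1)) - 1).toNat = n := by simp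
    simp only [S, if_neg h1, h2]
  have Z_nat : ∀ n : ℕ, Z n = ZU n := fun n => by
    simp only [Z, if_pos (Int.natCast_nonneg n), Int.toNat_natCast]
  have Z_neg : ∀ n : ℕ, Z (-(n : ℤ)) = ZD n := fun n => by
    rcases Nat.eq_zero_or_pos n with rfl | hn
    · simp [Z, ZU, ZD]
    · have h1 : ¬ (0 : ℤ) ≤ -(n : ℤ) := by omega
      simp only [Z, if_neg h1, neg_neg, Int.toNat_natCast]
  have hS : IsHaggSeq S := by
    intro k
    by_cases hk : 0 ≤ k
    · simp only [S, if_pos hk]; exact (hsd _ (hbU _)).2.1 0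
    · simp only [S, if_neg hk]; exact (hsd _ (hbD _)).2.1 (-1)
  -- the base points are the template's sites `(k, 0, 0)`
  have hZ0 : Z 0 = 0 := by
    simp only [Z, le_refl, if_true, Int.toNat_zero]
    rfl
  have up : ∀ n : ℕ, bU n = p₀ + ((haggLabel S n : ℝ) • barlowOffset a + Z n • layerNormal 1) := by
    intro n
    induction n with
    | zero => rw [bU_zero, Nat.cast_zero, hZ0, haggLabel_zero]; simp
    | succ n ih =>
      rw [bU_succ]
      set ν := sd (bU n) 0 with hν
      set h := zd (bU n) 1 with hh
      have e2 : Z ((n : ℤ) + 1) = Z n + h := by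
        rw [show (n : ℤ) + 1 = ((n + 1 : ℕ) : ℤ) by push_cast; rfl, Z_nat, Z_nat, ZU_succ]
      rw [ih, Nat.cast_succ, haggLabel_succ, S_nat n, ← hν, e2]
      push_cast
      module
  have down : ∀ n : ℕ, bD n = p₀ + ((haggLabel S (-(n : ℤ)) : ℝ) • barlowOffset a + Z (-(n : ℤ)) • layerNormal 1) := by
    intro n
    induction n with
    | zero => rw [bD_zero, Nat.cast_zero, neg_zero, hZ0, haggLabel_zero]; simp
    | succ n ih =>
      rw [bD_succ]
      set ν := sd (bD n) (-1) with hν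
      set h := zd (bD n) (-1) with hh
      have hrec : haggLabel S (-(n : ℤ)) = haggLabel S (-((n : ℤ) + 1)) + S (-((n : ℤ) + 1)) := by
        have := haggLabel_succ S (-((n : ℤ) + 1))
        rwa [show -((n : ℤ) + 1) + 1 = -(n : ℤ) by ring] at this
      have e1 : (haggLabel S (-((n + 1 : ℕ) : ℤ)) : ℝ) = haggLabel S (-(n : ℤ)) - ν := by
        rw [Nat.cast_succ, hrec, S_neg n, ← hν]; push_cast; ring
      have e2 : Z (-((n + 1 : ℕ) : ℤ)) = Z (-(n : ℤ)) + h := by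
        rw [Z_neg, Z_neg, ZD_succ]
      rw [ih, e1, e2]
      module
  -- heights are in the box
  have hbox : InBox a Z := by
    refine ⟨hbox0.1, hbox0.2.1, fun m => ?_⟩
    rcases le_or_gt 0 m with hm | hm
    · lift m to ℕ using hm
      have e : Z ((m : ℤ) + 1) - Z m = zd (bU m) 1 := by
        rw [show (m : ℤ) + 1 = ((m + 1 : ℕ) : ℤ) by push_cast; rfl, Z_nat, Z_nat, ZU_succ]; ring
      rw [e]
      have h := hsd _ (hbU m)
      exact h.1.z_one h.2.2.1
    · obtain ⟨n, rfl⟩ : ∃ n : ℕ, m = -((n : ℤ) + 1) := ⟨(-m - 1).toNat, by omega⟩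
      have e : Z (-((n : ℤ) + 1) + 1) - Z (-((n : ℤ) + 1)) = -zd (bD n) (-1) := by
        rw [show -((n : ℤ) + 1) + 1 = -(n : ℤ) by ring, show -((n : ℤ) + 1) = -((n + 1 : ℕ) : ℤ) by push_cast; rfl,
          Z_neg, Z_neg, ZD_succ]; ring
      rw [e]
      have h := hsd _ (hbD n)
      exact h.1.z_neg_one h.2.2.1
  -- heights of the base points
  have hw2 : (barlowOffset a) 2 = 0 := by simp [barlowOffset]
  have hn2 : (layerNormal 1 : EuclideanSpace ℝ (Fin 3)) 2 = 1 := by simp [layerNormal]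
  have bD_two : ∀ n : ℕ, (bD n) 2 = p₀ 2 + Z (-(n : ℤ)) := fun n => by
    rw [down n]; simp only [PiLp.add_apply, PiLp.smul_apply, smul_eq_mul, hw2, hn2]; ring
  -- consistency downwards: the upward increment read at `bD (n+1)` is the downward one read at `bD n`
  have hcons : ∀ n : ℕ, zd (bD (n + 1)) 1 = -zd (bD n) (-1) := by
    intro n
    have hc := hsd _ (hbD (n + 1))
    have hb := hsd _ (hbD n)
    have hc2 : (bD (n + 1)) 2 = (bD n) 2 + zd (bD n) (-1) := by
      rw [bD_two (n + 1), bD_two n, Z_neg, Z_neg, ZD_succ]; ring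
    have hzc := (hc.1.z_one hc.2.2.1).1
    have hzb := (hb.1.z_neg_one hb.2.2.1).1
    have hapos := hb.1.a_pos
    have h1 : ¬ (zd (bD (n + 1)) 1 < -zd (bD n) (-1)) := by
      intro hlt
      apply (no_between (hY.layerFramed (hbD n)) hb hc.up_mem).2
      simp only [PiLp.add_apply, PiLp.smul_apply, smul_eq_mul, hw2, hn2]
      rw [hc2]
      constructor <;> nlinarith
    have h2 : ¬ (-zd (bD n) (-1) < zd (bD (n + 1)) 1) := by
      intro hlt
      apply (no_between (hY.layerFramed (hbD (n + 1))) hc (hbD n)).1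
      rw [hc2]
      constructor <;> nlinarith
    exact le_antisymm (not_lt.1 h2) (not_lt.1 h1)
  -- base of layer `k`
  let base : ℤ → EuclideanSpace ℝ (Fin 3) := fun k => if 0 ≤ k then bU k.toNat else bD (-k).toNat
  have base_nat : ∀ n : ℕ, base n = bU n := fun n => by
    simp only [base, if_pos (Int.natCast_nonneg n), Int.toNat_natCast]
  have base_neg : ∀ n : ℕ, base (-(n : ℤ)) = bD n := fun n => by
    rcases Nat.eq_zero_or_pos n with rfl | hn
    · simp [base, bU_zero, bD_zero]
    · have h1 : ¬ (0 : ℤ) ≤ -(n : ℤ) := by omega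
      simp only [base, if_neg h1, neg_neg, Int.toNat_natCast]
  have base_eq : ∀ k : ℤ, base k = p₀ + ((haggLabel S k : ℝ) • barlowOffset a + Z k • layerNormal 1) := by
    intro k
    rcases le_or_gt 0 k with hk | hk
    · lift k to ℕ using hk
      rw [base_nat, up]
    · obtain ⟨n, rfl⟩ : ∃ n : ℕ, k = -(n : ℤ) := ⟨(-k).toNat, by omega⟩
      rw [base_neg, down]
  have hbase : ∀ k, base k ∈ Y := by
    intro k
    rcases le_or_gt 0 k with hk | hk
    · lift k to ℕ using hk
      rw [base_nat]; exact hbU k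
    · obtain ⟨n, rfl⟩ : ∃ n : ℕ, k = -(n : ℤ) := ⟨(-k).toNat, by omega⟩
      rw [base_neg]; exact hbD n
  have base_two : ∀ k, (base k) 2 = p₀ 2 + Z k := fun k => by
    rw [base_eq k]; simp only [PiLp.add_apply, PiLp.smul_apply, smul_eq_mul, hw2, hn2]; ring
  have hinc : ∀ k, zd (base k) 1 = Z (k + 1) - Z k := by
    intro k
    rcases le_or_gt 0 k with hk | hk
    · lift k to ℕ using hk
      rw [base_nat, show (k : ℤ) + 1 = ((k + 1 : ℕ) : ℤ) by push_cast; rfl, Z_nat, Z_nat, ZU_succ]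
      ring
    · obtain ⟨n, rfl⟩ : ∃ n : ℕ, k = -((n : ℤ) + 1) := ⟨(-k - 1).toNat, by omega⟩
      rw [show -((n : ℤ) + 1) = -((n + 1 : ℕ) : ℤ) by push_cast; rfl, base_neg, hcons n,
        show -((n + 1 : ℕ) : ℤ) + 1 = -(n : ℤ) by push_cast; ring, Z_neg, Z_neg, ZD_succ]
      ring
  -- `Z` is unbounded in both directions
  have hapos := hbox0.a_pos
  have hZge : ∀ n : ℕ, 39 / 50 * a * n ≤ Z n := fun n => by
    have := (hbox.le_z_natCast n).1; rwa [hZ0, sub_zero] at this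
  have hZle : ∀ n : ℕ, Z (-(n : ℤ)) ≤ -(39 / 50 * a * n) := fun n => by
    have := (hbox.le_z_neg_natCast n).1; rw [hZ0, zero_sub] at this; linarith
  -- the set equality
  refine ⟨S, Z, hbox, hS, hZ0, Set.Subset.antisymm ?_ ?_⟩
  · intro y hy
    set t : ℝ := y 2 - p₀ 2 with ht
    have hbdd : ∃ b : ℤ, ∀ k : ℤ, Z k ≤ t → k ≤ b := by
      refine ⟨max 0 ⌈t / (39 / 50 * a)⌉, fun k hk => ?_⟩
      rcases le_or_gt 0 k with h0 | h0
      · lift k to ℕ using h0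
        have h1 : 39 / 50 * a * k ≤ t := (hZge k).trans hk
        have h2 : (k : ℝ) ≤ t / (39 / 50 * a) := by rw [le_div_iff₀ (by positivity)]; linarith
        have h3 : (k : ℤ) ≤ ⌈t / (39 / 50 * a)⌉ := Int.le_ceil_iff.2 (by push_cast; linarith)
        exact h3.trans (le_max_right _ _)
      · exact h0.le.trans (le_max_left _ _)
    have hne : ∃ k : ℤ, Z k ≤ t := by
      obtain ⟨n, hn⟩ := exists_nat_ge (-t / (39 / 50 * a))
      refine ⟨-(n : ℤ), (hZle n).trans ?_⟩
      rw [div_le_iff₀ (by positivity)] at hn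
      linarith
    obtain ⟨k, hk, hkmax⟩ := Int.exists_greatest_of_bdd hbdd hne
    have hlt : t < Z (k + 1) := by
      by_contra h
      push Not at h
      have := hkmax (k + 1) h
      omega
    have hyk : y 2 = (base k) 2 := by
      rw [base_two]
      rcases eq_or_lt_of_le hk with h | h
      · rw [ht] at h; linarith
      · exfalso
        apply (no_between (hY.layerFramed (hbase k)) (hsd _ (hbase k)) hy).1
        rw [base_two, hinc]
        rw [ht] at h hlt
        constructor <;> linarith
    obtain ⟨i, j, hij⟩ := layer_exact (hY.layerFramed (hbase k)) hy hyk
    refine ⟨(k, i, j), ?_⟩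
    rw [hij, base_eq]
    simp only [layeredPos]
    module
  · rintro y ⟨⟨k, i, j⟩, rfl⟩
    have := layer_full hY (hbase k) i j
    rw [base_eq] at this
    convert this using 1
    simp only [layeredPos]
    module

end Framed

/-! ## Part I — site algebra of a box template -/

section Sites

variable {a : ℝ} {s : ℤ → ℤ} {z : ℤ → ℝ}

/-- Squared norm of a template site in coordinates. -/
theorem norm_sq_layeredPos (a : ℝ) (s : ℤ → ℤ) (z : ℤ → ℝ) (m i j : ℤ) :
    ‖layeredPos a s z (m, i, j)‖ ^ 2 =
      a ^ 2 * ((i : ℝ) ^ 2 + i * j + (j : ℝ) ^ 2 + (haggLabel s m : ℝ) * (i + j) +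
        (haggLabel s m : ℝ) ^ 2 / 3) + z m ^ 2 := by
  have h3 : (√3 : ℝ) ^ 2 = 3 := Real.sq_sqrt (by norm_num)
  rw [norm_sq_fin3, layeredPos_apply_zero, layeredPos_apply_one, layeredPos_apply_two]
  simp only
  linear_combination (a ^ 2 * ((j : ℝ) + haggLabel s m / 3) ^ 2 / 4) * h3

/-- Auxiliary step `haggLabel_one` of the proof of `stub_layeredGluing` (S5a); see the final part's module docstring. -/
theorem haggLabel_one (s : ℤ → ℤ) : haggLabel s 1 = s 0 := by
  have := haggLabel_succ s 0; simp only [zero_add, haggLabel_zero] at this; exact this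

/-- Integer solutions of `i² + ij + j² ≤ 1`. -/
theorem int_form_le_one {i j : ℤ} (h : i ^ 2 + i * j + j ^ 2 ≤ 1) :
    (i, j) = (0, 0) ∨ (i, j) = (1, 0) ∨ (i, j) = (-1, 0) ∨ (i, j) = (0, 1) ∨ (i, j) = (0, -1) ∨
      (i, j) = (1, -1) ∨ (i, j) = (-1, 1) := by
  have hj : j ^ 2 ≤ 1 := by nlinarith [sq_nonneg (2 * i + j)]
  have hi : i ^ 2 ≤ 1 := by nlinarith [sq_nonneg (2 * j + i)]
  have hj1 : -1 ≤ j ∧ j ≤ 1 := by constructor <;> nlinarith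
  have hi1 : -1 ≤ i ∧ i ≤ 1 := by constructor <;> nlinarith
  obtain ⟨hi1, hi2⟩ := hi1
  obtain ⟨hj1, hj2⟩ := hj1
  interval_cases i <;> interval_cases j <;> simp_all

/-- Integer solutions of `i² + ij + j² + σ(i + j) ≤ 0` for a sign `σ`. -/
theorem int_form_shift_le_zero {i j σ : ℤ} (hσ : σ = 1 ∨ σ = -1)
    (h : i ^ 2 + i * j + j ^ 2 + σ * (i + j) ≤ 0) :
    (i, j) = (0, 0) ∨ (i, j) = (-σ, 0) ∨ (i, j) = (0, -σ) := by
  rcases hσ with rfl | rfl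
  · have hj : (3 * j + 1) ^ 2 ≤ 4 := by nlinarith [sq_nonneg (2 * i + j + 1)]
    have hi : (3 * i + 1) ^ 2 ≤ 4 := by nlinarith [sq_nonneg (2 * j + i + 1)]
    have hj1 : -1 ≤ j ∧ j ≤ 0 := by constructor <;> nlinarith
    have hi1 : -1 ≤ i ∧ i ≤ 0 := by constructor <;> nlinarith
    obtain ⟨hi1, hi2⟩ := hi1
    obtain ⟨hj1, hj2⟩ := hj1
    interval_cases i <;> interval_cases j <;> simp_all
  · have hj : (3 * j - 1) ^ 2 ≤ 4 := by nlinarith [sq_nonneg (2 * i + j - 1)]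
    have hi : (3 * i - 1) ^ 2 ≤ 4 := by nlinarith [sq_nonneg (2 * j + i - 1)]
    have hj1 : 0 ≤ j ∧ j ≤ 1 := by constructor <;> nlinarith
    have hi1 : 0 ≤ i ∧ i ≤ 1 := by constructor <;> nlinarith
    obtain ⟨hi1, hi2⟩ := hi1
    obtain ⟨hj1, hj2⟩ := hj1
    interval_cases i <;> interval_cases j <;> simp_all

/-- Landing anchor of this file (registered stub of crux stmt-AtomisticToContinuum-13603; re-exports a result above). -/
theorem layeredGluing_part05_anchor :
    ∀ (s : ℤ → ℤ), haggLabel s 1 = s 0 :=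
  haggLabel_one

end Sites

end Summit.AtomisticToContinuum.Crystallization.Theorems.PrestressSplitKorn
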